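import Summits.KontsevichZagierPeriods.KontsevichZagierPeriods.Theorems.TerasomaMultiplicationMultiplicationAccessibleStubMultiplicativityGlueAux2

/-!
# `MultiplicationAccessible` (stmt-KontsevichZagierPeriods-12305), line `shifted-family-prime-sieve`,
stub `stub_glueFromParts` — book-keeping between the pinned and the Beta-box forms

The shifted Gauss-multiplication family `GM(n; x, s)` is stated in the skeleton in *pinned* form:
every box representation of `∏_{k<n} B(x + k/n, s)` (integrand
`∏ₖ zₖ^(x + k/n − 1)(1 − zₖ)^(s−1)` on `(0,1)^n`) is KZ-equivalent to every box representation of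
`n^{ns} B(nx, ns) ∏_{j=1}^{n−1} B(js, s)`.  The multiplicativity glue
(`stub_multiplicativityGlue_part4`) is stated in the *Beta-box* vocabulary of
`Theorems/TerasomaMultiplicationMultiplicationAccessibleStubMultiplicativityGlueAux*.lean`
(`∃ ρ₁ ρ₂` with integrands `κ ∏ᵢ zᵢ^(αᵢ−1)(1−zᵢ)^(βᵢ−1)`, rational exponent vectors).
This file proves the registered stub `stub_glueFromParts`: pinned `GM(a+1)` and `GM(b+1)` give the
Beta-box forms (`MultGlue.exists_betaRep` + the pinned hypothesis applied to the two Beta boxes),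
these are fed to the multiplicativity implication, and the resulting equivalence of
`(a+1)(b+1)`-dimensional Beta boxes is transported back to the pinned form at `m = ab + a + b`
along `finCongr` (`MultGlue.equiv_reindex`, `MultGlue.equivalent_of_equiv`).  No new move is used;
everything is cast and `Finset` book-keeping plus the constant identity
`(b+1)^{(b+1)(a+1)s} · ((a+1)^{(a+1)s})^{b+1} = (ab+a+b+1)^{(ab+a+b+1)s}`.
-/

noncomputable section

open MeasureTheory Set Real
open scoped BigOperators

namespace Summit.KontsevichZagierPeriods.TerasomaMultiplication.MultiplicationAccessible

namespace GlueFromParts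

open Literature.NumberTheory.Transcendental

/-! ## Pointwise identities between the pinned and the Beta-box integrands -/

/-- The left integrand of the shifted family: the Beta-box spelling
`1 · ∏ᵢ zᵢ^((x + i/(n+1)) − 1)(1−zᵢ)^(s−1)` (rational exponents) equals the pinned spelling
`∏ₖ zₖ^(x + k/(n+1) − 1)(1−zₖ)^(s−1)`. [folklore] -/
theorem gmLeft_eq (n : ℕ) (x s : ℚ) (z : Fin (n + 1) → ℝ) :
    (1:ℝ) * ∏ i : Fin (n + 1), ((z i) ^ (((x + (i : ℚ) / ((n : ℚ) + 1) : ℚ) : ℝ) - 1) *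
        (1 - z i) ^ (((s : ℚ) : ℝ) - 1)) =
      ∏ k : Fin (n + 1), (z k) ^ ((x:ℝ) + ((k:ℕ):ℝ) / ((n:ℝ) + 1) - 1) *
        (1 - z k) ^ ((s:ℝ) - 1) := by
  rw [one_mul]
  refine Finset.prod_congr rfl fun k _ => ?_
  congr 2
  push_cast
  ring

/-- Splitting off coordinate `0` of a Beta product whose exponent vectors are
`(W, s, 2s, …, ms)` and `(W', s, …, s)` (written with `if (k:ℕ) = 0`). [folklore] -/
theorem prod_ite_succ (m : ℕ) (W W' s : ℚ) (z : Fin (m + 1) → ℝ) :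
    ∏ k : Fin (m + 1), ((z k) ^ (((if (k : ℕ) = 0 then W else (k : ℚ) * s : ℚ) : ℝ) - 1) *
        (1 - z k) ^ (((if (k : ℕ) = 0 then W' else s : ℚ) : ℝ) - 1)) =
      (z 0) ^ ((W:ℝ) - 1) * (1 - z 0) ^ ((W':ℝ) - 1) *
        ∏ j : Fin m, ((z j.succ) ^ ((((j:ℕ):ℝ) + 1) * (s:ℝ) - 1) *
          (1 - z j.succ) ^ ((s:ℝ) - 1)) := by
  rw [Fin.prod_univ_succ]
  simp only [Fin.val_zero, Fin.val_succ, Nat.add_eq_zero_iff, one_ne_zero, and_false,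
    ↓reduceIte]
  push_cast
  ring

/-- The right integrand of the shifted family: Beta-box spelling (constant `(n+1)^((n+1)s)`,
exponent vectors `((n+1)x, s, 2s, …)` and `((n+1)s, s, …, s)`) equals the pinned spelling.
[folklore] -/
theorem gmRight_eq (n : ℕ) (x s : ℚ) (z : Fin (n + 1) → ℝ) :
    ((n:ℝ) + 1) ^ (((n:ℝ) + 1) * (s:ℝ)) *
        ∏ i : Fin (n + 1), ((z i) ^ ((((if (i : ℕ) = 0 then ((n : ℚ) + 1) * x
            else (i : ℚ) * s : ℚ)) : ℝ) - 1) *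
          (1 - z i) ^ ((((if (i : ℕ) = 0 then ((n : ℚ) + 1) * s else s : ℚ)) : ℝ) - 1)) =
      ((n:ℝ) + 1) ^ (((n:ℝ) + 1) * (s:ℝ)) *
        ((z 0) ^ (((n:ℝ) + 1) * (x:ℝ) - 1) * (1 - z 0) ^ (((n:ℝ) + 1) * (s:ℝ) - 1)) *
        ∏ j : Fin n, (z j.succ) ^ ((((j:ℕ):ℝ) + 1) * (s:ℝ) - 1) *
          (1 - z j.succ) ^ ((s:ℝ) - 1) := by
  rw [prod_ite_succ n (((n:ℚ) + 1) * x) (((n:ℚ) + 1) * s) s z]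
  push_cast
  ring

/-- The constant identity of the glue:
`1^(b+1) · (b+1)^((b+1)(a+1)s) · ((a+1)^((a+1)s))^(b+1) · 1 = (ab+a+b+1)^((ab+a+b+1)s)`.
[folklore] -/
theorem glueConst_eq (a b : ℕ) (s : ℚ) :
    (1:ℝ) ^ (b + 1) * (((b:ℝ) + 1) ^ (((b:ℝ) + 1) * (((((a:ℚ) + 1) * s : ℚ)) : ℝ)) *
        ((((a:ℝ) + 1) ^ (((a:ℝ) + 1) * (s:ℝ))) ^ (b + 1) * 1)) =
      (((a * b + a + b : ℕ):ℝ) + 1) ^ ((((a * b + a + b : ℕ):ℝ) + 1) * (s:ℝ)) := by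
  have ha : (0:ℝ) ≤ (a:ℝ) + 1 := by positivity
  have hb : (0:ℝ) ≤ (b:ℝ) + 1 := by positivity
  rw [one_pow, one_mul, mul_one, ← Real.rpow_mul_natCast ha]
  have e1 : ((b:ℝ) + 1) * (((((a:ℚ) + 1) * s : ℚ)) : ℝ) =
      ((a:ℝ) + 1) * ((b:ℝ) + 1) * (s:ℝ) := by
    push_cast; ring
  have e2 : ((a:ℝ) + 1) * (s:ℝ) * ((b + 1 : ℕ) : ℝ) =
      ((a:ℝ) + 1) * ((b:ℝ) + 1) * (s:ℝ) := by
    push_cast; ring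
  have e3 : (((a * b + a + b : ℕ):ℝ) + 1) = ((b:ℝ) + 1) * ((a:ℝ) + 1) := by
    push_cast; ring
  rw [e1, e2, ← Real.mul_rpow hb ha, e3]
  congr 1
  ring

/-- The left integrands over `Fin ((a+1)(b+1))` (Beta-box spelling) and over `Fin (ab+a+b+1)`
(pinned spelling) agree along `finCongr`. [folklore] -/
theorem gmLeft_reindex (a b : ℕ) (x s : ℚ) (h : a * b + a + b + 1 = (a + 1) * (b + 1))
    (w : Fin ((a + 1) * (b + 1)) → ℝ) :
    (1:ℝ) * ∏ k : Fin ((a + 1) * (b + 1)),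
        ((w k) ^ (((x + (k : ℚ) / (((a : ℚ) + 1) * ((b : ℚ) + 1)) : ℚ) : ℝ) - 1) *
          (1 - w k) ^ (((s : ℚ) : ℝ) - 1)) =
      ∏ k : Fin (a * b + a + b + 1),
        (w (finCongr h k)) ^ ((x:ℝ) + ((k:ℕ):ℝ) / (((a * b + a + b : ℕ):ℝ) + 1) - 1) *
          (1 - w (finCongr h k)) ^ ((s:ℝ) - 1) := by
  rw [one_mul]
  refine (Fintype.prod_equiv (finCongr h) _ _ fun k => ?_).symm
  rw [finCongr_apply_coe]
  congr 2
  push_cast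
  ring

/-- The right integrands over `Fin ((b+1)(a+1))` (Beta-box spelling, constant of
`stub_multiplicativityGlue_part4`) and over `Fin (ab+a+b+1)` (pinned spelling) agree along
`finCongr`. [folklore] -/
theorem gmRight_reindex (a b : ℕ) (x s : ℚ) (h : a * b + a + b + 1 = (b + 1) * (a + 1))
    (w : Fin ((b + 1) * (a + 1)) → ℝ) :
    ((1:ℝ) ^ (b + 1) * (((b:ℝ) + 1) ^ (((b:ℝ) + 1) * (((((a:ℚ) + 1) * s : ℚ)) : ℝ)) *
        ((((a:ℝ) + 1) ^ (((a:ℝ) + 1) * (s:ℝ))) ^ (b + 1) * 1))) *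
      ∏ k : Fin ((b + 1) * (a + 1)),
        ((w k) ^ ((((if (k : ℕ) = 0 then ((b : ℚ) + 1) * (((a : ℚ) + 1) * x)
            else (k : ℚ) * s : ℚ)) : ℝ) - 1) *
          (1 - w k) ^ ((((if (k : ℕ) = 0 then ((b : ℚ) + 1) * (((a : ℚ) + 1) * s)
            else s : ℚ)) : ℝ) - 1)) =
    (((a * b + a + b : ℕ):ℝ) + 1) ^ ((((a * b + a + b : ℕ):ℝ) + 1) * (s:ℝ)) *
      ((w (finCongr h 0)) ^ ((((a * b + a + b : ℕ):ℝ) + 1) * (x:ℝ) - 1) *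
        (1 - w (finCongr h 0)) ^ ((((a * b + a + b : ℕ):ℝ) + 1) * (s:ℝ) - 1)) *
      ∏ j : Fin (a * b + a + b), (w (finCongr h j.succ)) ^ ((((j:ℕ):ℝ) + 1) * (s:ℝ) - 1) *
        (1 - w (finCongr h j.succ)) ^ ((s:ℝ) - 1) := by
  rw [glueConst_eq, ← (finCongr h).prod_comp, Fin.prod_univ_succ]
  simp only [finCongr_apply_coe, Fin.val_zero, Fin.val_succ, Nat.add_eq_zero_iff, one_ne_zero,
    and_false, ↓reduceIte]
  have e1 : (((((b:ℚ) + 1) * (((a:ℚ) + 1) * x) : ℚ)) : ℝ) =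
      (((a * b + a + b : ℕ):ℝ) + 1) * (x:ℝ) := by
    push_cast; ring
  have e2 : (((((b:ℚ) + 1) * (((a:ℚ) + 1) * s) : ℚ)) : ℝ) =
      (((a * b + a + b : ℕ):ℝ) + 1) * (s:ℝ) := by
    push_cast; ring
  rw [e1, e2]
  push_cast
  ring

/-! ## From the pinned `∀ r r'` form to the Beta-box `∃ ρ₁ ρ₂` form -/

/-- The pinned form of the shifted family at `n + 1` (every pinned `r` is equivalent to every
pinned `r'`) yields the Beta-box form: take the two Beta boxes of `MultGlue.exists_betaRep` and
apply the pinned hypothesis to them. [folklore] -/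
theorem exists_of_forall (n : ℕ) (x s : ℚ) (hx : 0 < x) (hs : 0 < s)
    (h : ∀ (r r' : KZ.IntegralRep (n + 1)),
        r.domain = {z | ∀ i, z i ∈ Set.Ioo (0:ℝ) 1} →
        Set.EqOn r.integrand (fun z => ∏ k : Fin (n + 1),
          (z k) ^ ((x:ℝ) + ((k:ℕ):ℝ) / ((n:ℝ) + 1) - 1) * (1 - z k) ^ ((s:ℝ) - 1)) r.domain →
        r'.domain = {z | ∀ i, z i ∈ Set.Ioo (0:ℝ) 1} →
        Set.EqOn r'.integrand (fun z => ((n:ℝ) + 1) ^ (((n:ℝ) + 1) * (s:ℝ)) *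
          ((z 0) ^ (((n:ℝ) + 1) * (x:ℝ) - 1) * (1 - z 0) ^ (((n:ℝ) + 1) * (s:ℝ) - 1)) *
          ∏ j : Fin n, (z j.succ) ^ ((((j:ℕ):ℝ) + 1) * (s:ℝ) - 1) * (1 - z j.succ) ^ ((s:ℝ) - 1))
          r'.domain →
        KZ.Equivalent r r') :
    ∃ (ρ₁ : KZ.IntegralRep (n + 1)) (ρ₂ : KZ.IntegralRep (n + 1)),
      (ρ₁.domain = {z | ∀ i, z i ∈ Set.Ioo (0:ℝ) 1} ∧ Set.EqOn ρ₁.integrand (fun z => (1:ℝ) *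
        ∏ i, ((z i) ^ (((x + (i : ℚ) / ((n : ℚ) + 1) : ℚ) : ℝ) - 1) *
          (1 - z i) ^ (((s : ℚ) : ℝ) - 1))) ρ₁.domain) ∧
      (ρ₂.domain = {z | ∀ i, z i ∈ Set.Ioo (0:ℝ) 1} ∧ Set.EqOn ρ₂.integrand (fun z =>
        ((n:ℝ) + 1) ^ (((n:ℝ) + 1) * (s:ℝ)) *
        ∏ i, ((z i) ^ ((((if (i : ℕ) = 0 then ((n : ℚ) + 1) * x else (i : ℚ) * s : ℚ)) : ℝ) - 1) *
          (1 - z i) ^ ((((if (i : ℕ) = 0 then ((n : ℚ) + 1) * s else s : ℚ)) : ℝ) - 1)))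
        ρ₂.domain) ∧
      KZ.Equivalent ρ₁ ρ₂ := by
  obtain ⟨ρ₁, h₁d, h₁i⟩ := MultGlue.exists_betaRep (N := n + 1) 1 isAlgebraic_one
    (fun i => x + (i : ℚ) / ((n : ℚ) + 1)) (fun _ => s) (fun i => by positivity) (fun _ => hs)
  obtain ⟨ρ₂, h₂d, h₂i⟩ := MultGlue.exists_betaRep (N := n + 1)
    (((n:ℝ) + 1) ^ (((n:ℝ) + 1) * (s:ℝ))) (MultGlue.isAlgebraic_gaussConst n s)
    (fun i => if (i : ℕ) = 0 then ((n : ℚ) + 1) * x else (i : ℚ) * s)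
    (fun i => if (i : ℕ) = 0 then ((n : ℚ) + 1) * s else s)
    (fun i => by
      split_ifs with hi
      · positivity
      · exact mul_pos (Nat.cast_pos.mpr (Nat.pos_of_ne_zero hi)) hs)
    (fun i => by split_ifs <;> positivity)
  refine ⟨ρ₁, ρ₂, ⟨h₁d, h₁i⟩, ⟨h₂d, h₂i⟩,
    h ρ₁ ρ₂ h₁d (fun z hz => ?_) h₂d (fun z hz => ?_)⟩
  · exact (h₁i hz).trans (gmLeft_eq n x s z)
  · exact (h₂i hz).trans (gmRight_eq n x s z)

end GlueFromParts

open Literature.NumberTheory.Transcendental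

/-- **Registered stub `stub_glueFromParts`** (glue book-keeping, no new move): the pinned
`∀ r r'` forms of the shifted Gauss-multiplication family at `n₁ = a + 1` and `n₂ = b + 1` are
converted into the Beta-box `∃ ρ₁ ρ₂` forms (`GlueFromParts.exists_of_forall`), fed to the
multiplicativity implication (hypothesis, = `stub_multiplicativityGlue_part4`), and the resulting
equivalence of `(a+1)(b+1)`-dimensional Beta boxes is transported back to the pinned form at
`m = ab + a + b` along `finCongr` (`MultGlue.equiv_reindex`, `MultGlue.equiv_trans`,
`MultGlue.equivalent_of_equiv`; constant identity `GlueFromParts.glueConst_eq`). [folklore] -/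
theorem stub_glueFromParts :
    ∀ (a b : ℕ),
      (∀ (x s : ℚ), 0 < x → 0 < s → ∀ (r r' : KZ.IntegralRep (a + 1)),
        r.domain = {z | ∀ i, z i ∈ Set.Ioo (0:ℝ) 1} →
        Set.EqOn r.integrand (fun z => ∏ k : Fin (a + 1),
          (z k) ^ ((x:ℝ) + ((k:ℕ):ℝ) / ((a:ℝ) + 1) - 1) * (1 - z k) ^ ((s:ℝ) - 1)) r.domain →
        r'.domain = {z | ∀ i, z i ∈ Set.Ioo (0:ℝ) 1} →
        Set.EqOn r'.integrand (fun z => ((a:ℝ) + 1) ^ (((a:ℝ) + 1) * (s:ℝ)) *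
          ((z 0) ^ (((a:ℝ) + 1) * (x:ℝ) - 1) * (1 - z 0) ^ (((a:ℝ) + 1) * (s:ℝ) - 1)) *
          ∏ j : Fin a, (z j.succ) ^ ((((j:ℕ):ℝ) + 1) * (s:ℝ) - 1) * (1 - z j.succ) ^ ((s:ℝ) - 1))
          r'.domain →
        KZ.Equivalent r r') →
      (∀ (x s : ℚ), 0 < x → 0 < s → ∀ (r r' : KZ.IntegralRep (b + 1)),
        r.domain = {z | ∀ i, z i ∈ Set.Ioo (0:ℝ) 1} →
        Set.EqOn r.integrand (fun z => ∏ k : Fin (b + 1),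
          (z k) ^ ((x:ℝ) + ((k:ℕ):ℝ) / ((b:ℝ) + 1) - 1) * (1 - z k) ^ ((s:ℝ) - 1)) r.domain →
        r'.domain = {z | ∀ i, z i ∈ Set.Ioo (0:ℝ) 1} →
        Set.EqOn r'.integrand (fun z => ((b:ℝ) + 1) ^ (((b:ℝ) + 1) * (s:ℝ)) *
          ((z 0) ^ (((b:ℝ) + 1) * (x:ℝ) - 1) * (1 - z 0) ^ (((b:ℝ) + 1) * (s:ℝ) - 1)) *
          ∏ j : Fin b, (z j.succ) ^ ((((j:ℕ):ℝ) + 1) * (s:ℝ) - 1) * (1 - z j.succ) ^ ((s:ℝ) - 1))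
          r'.domain →
        KZ.Equivalent r r') →
      ((∀ (x s : ℚ), 0 < x → 0 < s →
        ∃ (ρ₁ : KZ.IntegralRep (a + 1)) (ρ₂ : KZ.IntegralRep (a + 1)),
          (ρ₁.domain = {z | ∀ i, z i ∈ Set.Ioo (0:ℝ) 1} ∧ Set.EqOn ρ₁.integrand (fun z => (1:ℝ) *
            ∏ i, ((z i) ^ (((x + (i : ℚ) / ((a : ℚ) + 1) : ℚ) : ℝ) - 1) *
              (1 - z i) ^ (((s : ℚ) : ℝ) - 1))) ρ₁.domain) ∧
          (ρ₂.domain = {z | ∀ i, z i ∈ Set.Ioo (0:ℝ) 1} ∧ Set.EqOn ρ₂.integrand (fun z =>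
            ((a:ℝ) + 1) ^ (((a:ℝ) + 1) * (s:ℝ)) *
            ∏ i, ((z i) ^ ((((if (i : ℕ) = 0 then ((a : ℚ) + 1) * x else (i : ℚ) * s : ℚ)) : ℝ) - 1) *
              (1 - z i) ^ ((((if (i : ℕ) = 0 then ((a : ℚ) + 1) * s else s : ℚ)) : ℝ) - 1)))
            ρ₂.domain) ∧
          KZ.Equivalent ρ₁ ρ₂) →
       (∀ (x s : ℚ), 0 < x → 0 < s →
        ∃ (ρ₁ : KZ.IntegralRep (b + 1)) (ρ₂ : KZ.IntegralRep (b + 1)),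
          (ρ₁.domain = {z | ∀ i, z i ∈ Set.Ioo (0:ℝ) 1} ∧ Set.EqOn ρ₁.integrand (fun z => (1:ℝ) *
            ∏ i, ((z i) ^ (((x + (i : ℚ) / ((b : ℚ) + 1) : ℚ) : ℝ) - 1) *
              (1 - z i) ^ (((s : ℚ) : ℝ) - 1))) ρ₁.domain) ∧
          (ρ₂.domain = {z | ∀ i, z i ∈ Set.Ioo (0:ℝ) 1} ∧ Set.EqOn ρ₂.integrand (fun z =>
            ((b:ℝ) + 1) ^ (((b:ℝ) + 1) * (s:ℝ)) *
            ∏ i, ((z i) ^ ((((if (i : ℕ) = 0 then ((b : ℚ) + 1) * x else (i : ℚ) * s : ℚ)) : ℝ) - 1) *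
              (1 - z i) ^ ((((if (i : ℕ) = 0 then ((b : ℚ) + 1) * s else s : ℚ)) : ℝ) - 1)))
            ρ₂.domain) ∧
          KZ.Equivalent ρ₁ ρ₂) →
       (∀ (x s : ℚ), 0 < x → 0 < s →
        ∃ (ρ₁ : KZ.IntegralRep ((a + 1) * (b + 1))) (ρ₂ : KZ.IntegralRep ((b + 1) * (a + 1))),
          (ρ₁.domain = {z | ∀ i, z i ∈ Set.Ioo (0:ℝ) 1} ∧ Set.EqOn ρ₁.integrand (fun z => (1:ℝ) *
            ∏ k, ((z k) ^ (((x + (k : ℚ) / (((a : ℚ) + 1) * ((b : ℚ) + 1)) : ℚ) : ℝ) - 1) *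
              (1 - z k) ^ (((s : ℚ) : ℝ) - 1))) ρ₁.domain) ∧
          (ρ₂.domain = {z | ∀ i, z i ∈ Set.Ioo (0:ℝ) 1} ∧ Set.EqOn ρ₂.integrand (fun z =>
            ((1:ℝ) ^ (b + 1) * (((b:ℝ) + 1) ^ (((b:ℝ) + 1) * (((((a:ℚ) + 1) * s : ℚ)) : ℝ)) *
              ((((a:ℝ) + 1) ^ (((a:ℝ) + 1) * (s:ℝ))) ^ (b + 1) * 1))) *
            ∏ k, ((z k) ^ ((((if (k : ℕ) = 0 then ((b : ℚ) + 1) * (((a : ℚ) + 1) * x)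
                else (k : ℚ) * s : ℚ)) : ℝ) - 1) *
              (1 - z k) ^ ((((if (k : ℕ) = 0 then ((b : ℚ) + 1) * (((a : ℚ) + 1) * s)
                else s : ℚ)) : ℝ) - 1))) ρ₂.domain) ∧
          KZ.Equivalent ρ₁ ρ₂)) →
      (∀ (x s : ℚ), 0 < x → 0 < s → ∀ (r r' : KZ.IntegralRep (a * b + a + b + 1)),
        r.domain = {z | ∀ i, z i ∈ Set.Ioo (0:ℝ) 1} →
        Set.EqOn r.integrand (fun z => ∏ k : Fin (a * b + a + b + 1),
          (z k) ^ ((x:ℝ) + ((k:ℕ):ℝ) / (((a * b + a + b : ℕ):ℝ) + 1) - 1) * (1 - z k) ^ ((s:ℝ) - 1)) r.domain →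
        r'.domain = {z | ∀ i, z i ∈ Set.Ioo (0:ℝ) 1} →
        Set.EqOn r'.integrand (fun z => (((a * b + a + b : ℕ):ℝ) + 1) ^ ((((a * b + a + b : ℕ):ℝ) + 1) * (s:ℝ)) *
          ((z 0) ^ ((((a * b + a + b : ℕ):ℝ) + 1) * (x:ℝ) - 1) * (1 - z 0) ^ ((((a * b + a + b : ℕ):ℝ) + 1) * (s:ℝ) - 1)) *
          ∏ j : Fin (a * b + a + b), (z j.succ) ^ ((((j:ℕ):ℝ) + 1) * (s:ℝ) - 1) * (1 - z j.succ) ^ ((s:ℝ) - 1))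
          r'.domain →
        KZ.Equivalent r r') := by
  intro a b hA hB hP4 x s hx hs r r' hr hri hr' hri'
  have hAB := hP4 (fun x s hx hs => GlueFromParts.exists_of_forall a x s hx hs (hA x s hx hs))
    (fun x s hx hs => GlueFromParts.exists_of_forall b x s hx hs (hB x s hx hs)) x s hx hs
  have h₁ : a * b + a + b + 1 = (a + 1) * (b + 1) := by ring
  have h₂ : a * b + a + b + 1 = (b + 1) * (a + 1) := by ring
  refine MultGlue.equivalent_of_equiv ?_ r r' hr hri hr' hri'
  refine MultGlue.equiv_trans (MultGlue.equiv_trans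
    (MultGlue.equiv_reindex (finCongr h₁) ⟨r, hr, hri⟩ fun w _ => ?_) hAB)
    (MultGlue.equiv_symm (MultGlue.equiv_reindex (finCongr h₂) ⟨r', hr', hri'⟩ fun w _ => ?_))
  · exact GlueFromParts.gmLeft_reindex a b x s h₁ w
  · exact GlueFromParts.gmRight_reindex a b x s h₂ w

end Summit.KontsevichZagierPeriods.TerasomaMultiplication.MultiplicationAccessible

end
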